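import Summits.QuantumFields.YangMills.Theorems.IsotropyFromPowerCountingCurvatureDensitiesOfBddRenormalisation
import Summits.QuantumFields.YangMills.Theorems.CurvatureBoostCovariance.Negative.BetaZeroTie
import HarnessLib

/-!
# `CurvatureDensities` (Step 0) on the TAME SECTOR of Wilson schemes; the obstruction, if any, lives at
# `|c_k| → ∞` with `β_k ≠ 0`

Support file for the item `IsotropyFromPowerCounting.CurvatureDensities` (stmt-QuantumFields-17723):
`W1 r sch S₁ → EightFrameRP S₁ → PlanarCone S₁ → NPointRegular S₁` for every compact simple `G`, lattice
representation `r`, scheme `sch` and tied one-species family `S₁` (every `𝔖ₙ|⁰𝒮` of the curvature channel is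
integration against a function).

The item is universally quantified over ALL sequential Wilson schemes `sch = (a_k, β_k, L_k, c_k, m_k)`.  This file
proves it on the TAME SECTOR — every scheme which, for infinitely many `k`, is at zero coupling OR has multiplicative
renormalisation of the curvature species below a fixed bound:

* `torusMoment_zero_coupling`, `wilsonTorusMean_zero_coupling` — at `β = 0` the centred torus moments of the Wilson
  action density at torus-distinct sites are the moments of a CONSTANT, `(6 d₀ − m)ⁿ`, `d₀ = ∫ Re tr ρ dHaar` (the
  landed private-edge formula `integral_prod_actionDensity_sub` read through `torusMoment`);
* `nPointRegular_of_frequently_tame` — if `S₁` is tied to `(r, sch)` (first clause of `W1`), `𝔖₀ ≡ 1`, and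
  `∃ B, ∃ᶠ k, β_k = 0 ∨ |c_k| ≤ B`, then `NPointRegular S₁`.  Proof: pass to the subsequence scheme along the tame
  steps (a subsequence of a scheme is a scheme and inherits the tie); there the TRUE renormalised densities
  `c_kⁿ W_k` are bounded on injective multi-sites — by `Kⁿ` at zero-coupling steps (`K` a bound of the renormalised
  mean `κ_k = c_k(⟨F⟩_k − m_k)`, which the degree-one tie keeps bounded, landed `eventually_abs_renormalisedMean_le`)
  and by `(2BM + K)ⁿ` at bounded-`c` steps (landed `abs_trueDensity_le`) — so the landed pointwise Step-0 glue
  `stub_stepZeroOfLattice` (p137944) applies along the subsequence;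
* `nPointRegular_of_frequently_zero_coupling` (ANY `c_k, m_k`), `nPointRegular_of_frequently_abs_c_le`
  (generalising the landed `∀ k, |c_k| ≤ B` sector of p141110 to `liminf |c_k| < ∞`);
* the contrapositives `tendsto_abs_c_atTop_of_not_nPointRegular`, `eventually_beta_ne_zero_of_not_nPointRegular`:
  a tied family that is NOT `NPointRegular` forces `|c_k| → ∞` AND `β_k ≠ 0` for all large `k`;
* `curvatureDensities_tameSector` (the item with the one extra tameness hypothesis) and
  `curvatureDensities_iff_wildSector`: the item is EQUIVALENT to its restriction to the wild sector
  `|c_k| → ∞ ∧ ∀ᶠ k, β_k ≠ 0` — the regime of the genuine weak-coupling continuum limit, where it is the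
  content of crux T (`TemperedCurvatureMoments`, by the landed `curvatureDensities_of_temperedCurvatureMoments`).

Only the tie and E0 of `W1` are used; the eight frames and the cone are idle on the tame sector.

References: K. Osterwalder, E. Seiler, Ann. Phys. 110 (1978) §2 (strong coupling / independent links);
J. Glimm, A. Jaffe, Quantum Physics (1987) §6.1; K. Osterwalder, R. Schrader, Comm. Math. Phys. 31 (1973) §2.
-/

noncomputable section

open scoped SchwartzMap BigOperators
open MeasureTheory Filter Topology
open Literature.MathematicalPhysics.QuantumFieldTheory Literature.MathematicalPhysics.QuantumLattice
open Literature.MathematicalPhysics.AQFT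
open Literature.Probability.LatticeModels (box Site Torus.proj)
open Summit.QuantumFields.YangMills.Theorems.OSLegsFromFemtoAndGap (torusMoment torusE_dens_eq_wilsonTorusMean)
open Summit.QuantumFields.YangMills.Cruxes.OSLegsFromFemtoAndGap.DlrCollarTransfer (torusE dens)
open Summit.QuantumFields.YangMills.Theorems.CurvatureBoostCovariance.Negative
  (Tie W1 EightFrameRP PlanarCone haarTraceRe integral_prod_actionDensity_sub proj_injOn_box eventually_lt_side)
open Summit.QuantumFields.YangMills.Theorems.NPointIsotropy.Negative (E4 NPointRegular)
open Summit.QuantumFields.YangMills.Theorems.SoftKernelBoostCovariance.Sketch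
  (stub_stepZeroOfLattice temperedCurvatureMoments_of_trueDensity_tempered eventually_abs_renormalisedMean_le
    abs_trueDensity_le)

namespace Summit.QuantumFields.YangMills.Theorems.CurvatureDensities

variable {G : Type} [Group G] [TopologicalSpace G] [IsTopologicalGroup G] [CompactSpace G]
  [MeasurableSpace G] [BorelSpace G]

/-! ## Zero coupling: the torus moments of the action density are moments of a constant -/

/-- **Torus moments of the curvature at zero coupling.**  For `n < 2L+1` sites of `ℤ⁴` pairwise distinct on the
torus of side `2L+1` and any additive counterterm `m`,
`torusMoment r.ρ 0 L r.curvature.F m x = (6 d₀ − m)ⁿ`, `d₀ = ∫ Re tr ρ dHaar`: at `β = 0` Wilson's measure is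
product Haar and every product of centred plaquette traces at distinct base points has a private edge. -/
theorem torusMoment_zero_coupling (r : LatticeRep G) (L : ℕ) (m : ℝ) {n : ℕ} (x : Fin n → Site 4)
    (hinj : Function.Injective fun i => Torus.proj (2 * L + 1) (x i)) (hn : n < 2 * L + 1) :
    torusMoment r.ρ 0 L r.curvature.F m x = (6 * haarTraceRe r.ρ - m) ^ n := by
  haveI : SecondCountableTopology G :=
    (r.continuous.isClosedEmbedding r.injective).isEmbedding.secondCountableTopology
  have hcurv : r.curvature.F = actionDensity r.ρ := rfl
  unfold torusMoment
  rw [Theorems.LatticeGapOnTrajectory.Negative.wilsonMeasure_zero_coupling, hcurv]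
  exact integral_prod_actionDensity_sub r.ρ r.continuous x hinj hn m

/-- The torus Wilson mean of the action density is its degree-one torus moment with zero counterterm (translation
invariance of Wilson's measure on the torus, landed `torusE_dens_eq_wilsonTorusMean`). -/
theorem wilsonTorusMean_eq_torusMoment_one (r : LatticeRep G) (β : ℝ) (L : ℕ) :
    wilsonTorusMean r.ρ β L r.curvature.F = torusMoment r.ρ β L r.curvature.F 0 (fun _ : Fin 1 => (0 : Site 4)) := by
  rw [← torusE_dens_eq_wilsonTorusMean r β L (0 : Site 4)]
  simp only [torusMoment, torusE, dens, Fin.prod_univ_one, sub_zero]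

/-- **The torus Wilson mean of the action density at zero coupling** is `6 d₀` (torus side `2L+1 ≥ 3`). -/
theorem wilsonTorusMean_zero_coupling (r : LatticeRep G) {L : ℕ} (hL : 0 < L) :
    wilsonTorusMean r.ρ 0 L r.curvature.F = 6 * haarTraceRe r.ρ := by
  rw [wilsonTorusMean_eq_torusMoment_one,
    torusMoment_zero_coupling r L 0 (fun _ : Fin 1 => (0 : Site 4)) (Function.injective_of_subsingleton _)
      (by omega)]
  ring

/-! ## `NPointRegular` on the tame sector -/

/-- **STEP 0 ON THE TAME SECTOR.**  Let `S₁` be tied to `(r, sch)` (convergence of the renormalised Wilson strings of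
the curvature on off-diagonal real tensors) with `𝔖₀ ≡ 1`, and suppose that for some `B`, FREQUENTLY along the
scheme, `β_k = 0` or `|c_k| ≤ B`.  Then every `𝔖ₙ|⁰𝒮` is integration against a function: `NPointRegular S₁`.
Along the subsequence of tame steps (again a scheme, inheriting the tie) the true renormalised densities
`c_kⁿ W_k` are bounded on injective multi-sites for large `k` — `|κ_k|ⁿ ≤ Kⁿ` at zero coupling
(`torusMoment_zero_coupling`; `K` bounds the renormalised mean by the degree-one tie) and `(2BM + K)ⁿ` at bounded
`c` — so the landed glue `stub_stepZeroOfLattice` (tempered tied approximants ⇒ `NPointRegular`) applies. -/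
theorem nPointRegular_of_frequently_tame (r : LatticeRep G) (sch : SpeciesScheme (YMSpecies G))
    (S₁ : SchwingerFamily E4) (htie : Tie r sch S₁) (h0 : S₁.toLabelled.IsNormalized)
    (h : ∃ B : ℝ, ∃ᶠ k in atTop, sch.β k = 0 ∨ |sch.c r.curvature k| ≤ B) : NPointRegular S₁ := by
  obtain ⟨B, hB⟩ := h
  obtain ⟨φ, hφ, hφP⟩ := extraction_of_frequently_atTop hB
  have hφt : Tendsto φ atTop atTop := hφ.tendsto_atTop
  -- the subsequence scheme along the tame steps
  let sch' : SpeciesScheme (YMSpecies G) :=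
    { a := fun k => sch.a (φ k)
      a_pos := fun k => sch.a_pos (φ k)
      tendsto_a := sch.tendsto_a.comp hφt
      β := fun k => sch.β (φ k)
      L := fun k => sch.L (φ k)
      tendsto_L := sch.tendsto_L.comp hφt
      c := fun s k => sch.c s (φ k)
      m := fun s k => sch.m s (φ k) }
  have hLS : ∀ (k n : ℕ) (f : Fin n → 𝓢(E4, ℝ)),
      latticeSchwinger r.ρ sch' (fun s => s.F) k n (fun _ => r.curvature) f =
        latticeSchwinger r.ρ sch (fun s => s.F) (φ k) n (fun _ => r.curvature) f := fun _ _ _ => rfl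
  have htie' : Tie r sch' S₁ := by
    intro n hn f F hF hF'
    refine ((htie n hn f F hF hF').comp hφt).congr fun k => ?_
    simp only [Function.comp_apply, hLS]
  obtain ⟨M, hM⟩ := r.curvature.bounded
  obtain ⟨K, hK⟩ := eventually_abs_renormalisedMean_le r sch' S₁ htie'
  obtain ⟨k₁, hk₁⟩ := eventually_atTop.1 hK
  refine stub_stepZeroOfLattice sch'.a sch'.L S₁ sch'.a_pos sch'.tendsto_a sch'.tendsto_L h0 fun n hn => ?_
  obtain ⟨k₂, hk₂⟩ := eventually_atTop.1 (eventually_lt_side sch' n)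
  refine temperedCurvatureMoments_of_trueDensity_tempered r sch' S₁ htie' hn
    ⟨|2 * B * M + K| ^ n + |K| ^ n + 1, 0, max k₁ k₂, by positivity, fun k hk x hx hxinj => ?_⟩
  have hk1 : k₁ ≤ k := (le_max_left _ _).trans hk
  have hk2 : k₂ ≤ k := (le_max_right _ _).trans hk
  have hKn : 0 ≤ |K| ^ n := pow_nonneg (abs_nonneg _) n
  have hBn : 0 ≤ |2 * B * M + K| ^ n := pow_nonneg (abs_nonneg _) n
  simp only [pow_zero, mul_one]
  rcases hφP k with hβ | hc
  · -- a zero-coupling step: the true density is the constant `κ_kⁿ`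
    have hside : n < 2 * sch'.L k + 1 := hk₂ k hk2
    have hL : 0 < sch'.L k := by omega
    have hinj' : Function.Injective fun i => Torus.proj (2 * sch'.L k + 1) (x i) :=
      fun i j hij => hxinj (proj_injOn_box (sch'.L k) (hx i) (hx j) hij)
    have hβ' : sch'.β k = 0 := hβ
    have hκ := hk₁ k hk1
    rw [hβ', wilsonTorusMean_zero_coupling r hL] at hκ
    rw [hβ', torusMoment_zero_coupling r (sch'.L k) _ x hinj' hside, ← mul_pow, abs_pow]
    calc |sch'.c r.curvature k * (6 * haarTraceRe r.ρ - sch'.m r.curvature k)| ^ n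
        ≤ |K| ^ n := pow_le_pow_left₀ (abs_nonneg _) (hκ.trans (le_abs_self K)) n
      _ ≤ |2 * B * M + K| ^ n + |K| ^ n + 1 := by linarith
  · -- a bounded-renormalisation step
    calc |sch'.c r.curvature k ^ n *
            torusMoment r.ρ (sch'.β k) (sch'.L k) r.curvature.F (sch'.m r.curvature k) x|
        ≤ (2 * B * M + K) ^ n := abs_trueDensity_le r sch' hM k hc (hk₁ k hk1) x
      _ ≤ |2 * B * M + K| ^ n := by rw [← abs_pow]; exact le_abs_self _
      _ ≤ |2 * B * M + K| ^ n + |K| ^ n + 1 := by linarith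

/-- **Step 0 along every scheme at zero coupling frequently — ANY renormalisation `c_k, m_k`.**  (`W1` supplies the
tie and E0; the landed `β ≡ 0` collapse `tie_beta_zero_factorises` says such a family is a c-number field on
off-diagonal real tensors; here its `⁰𝒮`-densities are certified to be functions.) -/
theorem nPointRegular_of_frequently_zero_coupling (r : LatticeRep G) (sch : SpeciesScheme (YMSpecies G))
    (S₁ : SchwingerFamily E4) (hW : W1 r sch S₁) (hβ : ∃ᶠ k in atTop, sch.β k = 0) : NPointRegular S₁ :=
  nPointRegular_of_frequently_tame r sch S₁ hW.1 hW.2.1.1 ⟨0, hβ.mono fun _ hk => Or.inl hk⟩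

/-- **Step 0 along every scheme with `liminf |c_k| < ∞`** (bounded multiplicative renormalisation FREQUENTLY;
generalises the landed `∀ k, |c_k| ≤ B` sector `nPointRegular_of_bddRenormalisation`). -/
theorem nPointRegular_of_frequently_abs_c_le (r : LatticeRep G) (sch : SpeciesScheme (YMSpecies G))
    (S₁ : SchwingerFamily E4) (hW : W1 r sch S₁) (hc : ∃ B : ℝ, ∃ᶠ k in atTop, |sch.c r.curvature k| ≤ B) :
    NPointRegular S₁ := by
  obtain ⟨B, hB⟩ := hc
  exact nPointRegular_of_frequently_tame r sch S₁ hW.1 hW.2.1.1 ⟨B, hB.mono fun _ hk => Or.inr hk⟩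

/-! ## Where an obstruction must live -/

/-- **A non-regular tied family forces `|c_k| → ∞`.**  If `W1 r sch S₁` and some `𝔖ₙ|⁰𝒮` is NOT integration
against a function, the multiplicative renormalisation of the curvature species tends to infinity in absolute
value along the WHOLE scheme. -/
theorem tendsto_abs_c_atTop_of_not_nPointRegular (r : LatticeRep G) (sch : SpeciesScheme (YMSpecies G))
    (S₁ : SchwingerFamily E4) (hW : W1 r sch S₁) (h : ¬ NPointRegular S₁) :
    Tendsto (fun k => |sch.c r.curvature k|) atTop atTop := by
  by_contra hnot
  refine h (nPointRegular_of_frequently_abs_c_le r sch S₁ hW ?_)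
  rw [tendsto_atTop] at hnot
  obtain ⟨B, hB⟩ := not_forall.1 hnot
  exact ⟨B, (not_eventually.1 hB).mono fun _ hk => (not_le.1 hk).le⟩

/-- **A non-regular tied family forces `β_k ≠ 0` eventually.**  If `W1 r sch S₁` and `S₁` is NOT `NPointRegular`,
the scheme is at non-zero coupling for all large `k`. -/
theorem eventually_beta_ne_zero_of_not_nPointRegular (r : LatticeRep G) (sch : SpeciesScheme (YMSpecies G))
    (S₁ : SchwingerFamily E4) (hW : W1 r sch S₁) (h : ¬ NPointRegular S₁) : ∀ᶠ k in atTop, sch.β k ≠ 0 := by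
  by_contra hnot
  exact h (nPointRegular_of_frequently_zero_coupling r sch S₁ hW
    ((not_eventually.1 hnot).mono fun _ hk => not_not.1 hk))

/-! ## The item on the tame sector; reduction of the item to the wild sector -/

/-- **`CurvatureDensities` ON THE TAME SECTOR** — the item with one extra hypothesis: for every compact simple `G`,
`r`, `sch`, `S₁` with `W1 r sch S₁` (only the tie and E0 are used), the eight frames and the cone (idle), IF
frequently along the scheme `β_k = 0` or `|c_k| ≤ B`, then `NPointRegular S₁`. -/
theorem curvatureDensities_tameSector :
    ∀ (G : Type) [Group G] [TopologicalSpace G] [IsTopologicalGroup G] [CompactSpace G]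
      [MeasurableSpace G] [BorelSpace G], IsCompactSimpleLieGroup G →
      ∀ (r : LatticeRep G) (sch : SpeciesScheme (YMSpecies G)) (S₁ : SchwingerFamily E4),
        W1 r sch S₁ → EightFrameRP S₁ → PlanarCone S₁ →
        (∃ B : ℝ, ∃ᶠ k in atTop, sch.β k = 0 ∨ |sch.c r.curvature k| ≤ B) → NPointRegular S₁ :=
  fun _G _ _ _ _ _ _ _ r sch S₁ hW _ _ h => nPointRegular_of_frequently_tame r sch S₁ hW.1 hW.2.1.1 h

/-- **The item is equivalent to its restriction to the WILD SECTOR** `|c_k| → ∞ ∧ ∀ᶠ k, β_k ≠ 0` (the regime of the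
weak-coupling continuum limit with the physical renormalisation `c_k ≍ a_k⁻⁴` of `tr F²`): every other scheme is
covered by `curvatureDensities_tameSector`. -/
theorem curvatureDensities_iff_wildSector :
    Summit.QuantumFields.YangMills.Theses.IsotropyFromPowerCounting.CurvatureDensities ↔
      ∀ (G : Type) [Group G] [TopologicalSpace G] [IsTopologicalGroup G] [CompactSpace G]
        [MeasurableSpace G] [BorelSpace G], IsCompactSimpleLieGroup G →
        ∀ (r : LatticeRep G) (sch : SpeciesScheme (YMSpecies G)) (S₁ : SchwingerFamily E4),
          W1 r sch S₁ → EightFrameRP S₁ → PlanarCone S₁ →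
          Tendsto (fun k => |sch.c r.curvature k|) atTop atTop → (∀ᶠ k in atTop, sch.β k ≠ 0) →
          NPointRegular S₁ := by
  constructor
  · intro h G _ _ _ _ _ _ hG r sch S₁ hW h8 hC _ _
    exact h G hG r sch S₁ hW h8 hC
  · intro h G _ _ _ _ _ _ hG r sch S₁ hW h8 hC
    by_contra hN
    exact hN (h G hG r sch S₁ hW h8 hC (tendsto_abs_c_atTop_of_not_nPointRegular r sch S₁ hW hN)
      (eventually_beta_ne_zero_of_not_nPointRegular r sch S₁ hW hN))

end Summit.QuantumFields.YangMills.Theorems.CurvatureDensities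

end
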